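import Literature.AlgebraicGeometry.Resolution.AbhyankarRationalUniformization
import Mathlib.RingTheory.Valuation.ValuationSubring
import Mathlib.Algebra.MvPolynomial.CommRing
import Mathlib.Data.Finsupp.Weight
import HarnessLib

/-!
# Perron monomialization on a very good chart, I: the dominant term of the `𝔭`-adic expansion

Crux `Valuative.LuAlphaPTorsor` (item `stmt-ResolutionOfSingularities-0641`), line
`pfaff-line-log-final-forms`: helper file for the registered stub `stub_perronMonomialization`
(S3, `ValuativeLuAlphaPTorsorPerronMonomialization.lean`, which imports this file), proving the
registered helper stub `stub_perronDominantTerm` (Steps 1–2 of Zariski–Perron).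

Setting (a "very good chart"): `k ⊆ K` fields, `O` a valuation ring of `K`, `R ⊆ O` a
`k`-subalgebra with `hRO : R.toSubring ≤ O.toSubring`, parameters `x₁, …, xₙ ∈ R`; the CENTRE of
`R` is `Ideal.comap (Subring.inclusion hRO) (maximalIdeal O)` (membership is `v < 1`,
`perron_mem_centre_iff`), and the chart hypothesis `hcen` says that it is generated by the `xᵢ`.

* `perron_exists_coeffs` — an element of `R` of value `< 1` is `∑ xᵢ cᵢ`, `cᵢ ∈ R`.
* `perron_exists_expansion` — the `𝔭`-adic expansion to depth `N`: every `r ∈ R` is a polynomial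
  `∑ c_μ x^μ` (an `MvPolynomial (Fin n) K` with coefficients in `R`, evaluated at `x`) whose
  coefficients in degree `< N` have value `1` (induction on `N`, expanding the non-unit
  coefficients of degree `N` along `c = ∑ xᵢ dᵢ`).
* `perron_exists_bound` — RANK ONE (`∀ z w, v z < 1 → w ≠ 0 → ∃ N, v z ^ N < v w`): monomials
  of degree `≥ N` have value `< v(a)`.
* `perron_exp_eq_of_val_eq` — `ℤ`-independence of the `v(xᵢ)` makes `μ ↦ v(x^μ)` injective.
* `stub_perronDominantTerm` — a non-zero `a ∈ R` is `∑ c_μ x^μ` with a distinguished `μ₀` whose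
  coefficient is a unit and whose monomial value strictly dominates all the other monomials
  present (the strict ultrametric inequality `Valuation.map_sum_eq_of_lt` does the rest).

## Sources

S. D. Cutkosky, *Local uniformization of Abhyankar valuations*, Michigan Math. J. 71 (2022),
proof of Thm. 1.2 (1) (the Perron transform along a rank-one Abhyankar valuation: expansion of
an element of the chart in the monomial generators of the centre up to a dominant term);
O. Zariski, *Local uniformization on algebraic varieties*, Ann. of Math. 41 (1940). The lemmas
are standard valuation theory ([folklore]).
-/

-- single-problem summit: the doubled namespace component `ResolutionOfSingularities` is forced
set_option linter.dupNamespace false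

namespace Summit.ResolutionOfSingularities.ResolutionOfSingularities.Theorems.PfaffLine

open IsLocalRing Literature.AlgebraicGeometry.Resolution

section Expansion

variable {k K : Type} [Field k] [Field K] [Algebra k K] (O : ValuationSubring K)

/-- Membership in the centre `𝔪_O ∩ R` of a subalgebra `R ⊆ O` is `v < 1`. [folklore] -/
theorem perron_mem_centre_iff (R : Subalgebra k K) (hRO : R.toSubring ≤ O.toSubring) {z : K}
    (hz : z ∈ R) :
    (⟨z, hz⟩ : R.toSubring) ∈ Ideal.comap (Subring.inclusion hRO) (maximalIdeal O) ↔
      O.valuation z < 1 := by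
  rw [Ideal.mem_comap]
  exact ValuationSubring.valuation_lt_one_iff O _

/-- On a chart whose centre is generated by `x₁, …, xₙ`, an element of `R` of value `< 1` is
`∑ xᵢ cᵢ` with `cᵢ ∈ R`. [folklore] -/
theorem perron_exists_coeffs {n : ℕ} (R : Subalgebra k K) (hRO : R.toSubring ≤ O.toSubring)
    (x : Fin n → K) (hx : ∀ i, x i ∈ R)
    (hcen : Ideal.span (Set.range fun i => (⟨x i, hx i⟩ : R.toSubring)) =
      Ideal.comap (Subring.inclusion hRO) (maximalIdeal O))
    {r : K} (hr : r ∈ R) (hv : O.valuation r < 1) :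
    ∃ c : Fin n → K, (∀ i, c i ∈ R) ∧ r = ∑ i, x i * c i := by
  have hmem : (⟨r, hr⟩ : R.toSubring) ∈
      Ideal.span (Set.range fun i => (⟨x i, hx i⟩ : R.toSubring)) := by
    rw [hcen]
    exact (perron_mem_centre_iff O R hRO hr).mpr hv
  obtain ⟨c, hc⟩ := Ideal.mem_span_range_iff_exists_fun.mp hmem
  refine ⟨fun i => (c i : K), fun i => (c i).2, ?_⟩
  have h := congrArg Subtype.val hc
  push_cast at h
  rw [← h]
  exact Finset.sum_congr rfl fun i _ => mul_comm _ _

/-- **`𝔭`-adic expansion to depth `N`.** On a chart whose centre is generated by `x₁, …, xₙ`,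
every `r ∈ R` is `∑_μ c_μ x^μ` (a polynomial in `x` with coefficients in `R`) whose coefficients
in degree `< N` are units of `O` (value `1`): expand the non-unit coefficients of degree `N` along
`c = ∑ xᵢ dᵢ`. [folklore] -/
theorem perron_exists_expansion {n : ℕ} (R : Subalgebra k K) (hRO : R.toSubring ≤ O.toSubring)
    (x : Fin n → K) (hx : ∀ i, x i ∈ R)
    (hcen : Ideal.span (Set.range fun i => (⟨x i, hx i⟩ : R.toSubring)) =
      Ideal.comap (Subring.inclusion hRO) (maximalIdeal O))
    (N : ℕ) {r : K} (hr : r ∈ R) :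
    ∃ P : MvPolynomial (Fin n) K, (∀ μ, P.coeff μ ∈ R) ∧
      (∀ μ ∈ P.support, Finsupp.degree μ < N → O.valuation (P.coeff μ) = 1) ∧
      MvPolynomial.eval x P = r := by
  classical
  induction N with
  | zero =>
    refine ⟨MvPolynomial.C r, fun μ => ?_, fun μ _ h => (Nat.not_lt_zero _ h).elim,
      MvPolynomial.eval_C _⟩
    rw [MvPolynomial.coeff_C]
    split_ifs
    · exact hr
    · exact R.zero_mem
  | succ N ih =>
    obtain ⟨P, hPR, hPv, hPe⟩ := ih
    -- the exponents of degree `N` with a non-unit coefficient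
    set T : Finset (Fin n →₀ ℕ) :=
      P.support.filter fun μ => Finsupp.degree μ = N ∧ O.valuation (P.coeff μ) < 1 with hT
    have hd : ∀ μ : Fin n →₀ ℕ, ∃ d : Fin n → K,
        μ ∈ T → (∀ i, d i ∈ R) ∧ P.coeff μ = ∑ i, x i * d i := by
      intro μ
      by_cases hμ : μ ∈ T
      · obtain ⟨d, hdR, hdeq⟩ :=
          perron_exists_coeffs O R hRO x hx hcen (hPR μ) (Finset.mem_filter.mp hμ).2.2
        exact ⟨d, fun _ => ⟨hdR, hdeq⟩⟩
      · exact ⟨0, fun h => (hμ h).elim⟩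
    choose d hd using hd
    have hevalA : ∀ (μ : Fin n →₀ ℕ) (c : K),
        MvPolynomial.eval x (MvPolynomial.monomial μ c) = c * ∏ j, x j ^ (μ j) := by
      intro μ c
      rw [MvPolynomial.eval_monomial, Finsupp.prod_pow]
    set P' : MvPolynomial (Fin n) K :=
      P - ∑ μ ∈ T, MvPolynomial.monomial μ (P.coeff μ) +
        ∑ μ ∈ T, ∑ i, MvPolynomial.monomial (μ + Finsupp.single i 1) (d μ i) with hP'
    have hcoeff : ∀ ν, P'.coeff ν = P.coeff ν - (if ν ∈ T then P.coeff ν else 0) +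
        ∑ μ ∈ T, ∑ i, (if μ + Finsupp.single i 1 = ν then d μ i else 0) := by
      intro ν
      simp only [hP', MvPolynomial.coeff_add, MvPolynomial.coeff_sub, MvPolynomial.coeff_sum,
        MvPolynomial.coeff_monomial, Finset.sum_ite_eq']
    have hsum0 : ∀ ν : Fin n →₀ ℕ, Finsupp.degree ν ≤ N →
        (∑ μ ∈ T, ∑ i, (if μ + Finsupp.single i 1 = ν then d μ i else (0 : K))) = 0 := by
      intro ν hν
      refine Finset.sum_eq_zero fun μ hμ => Finset.sum_eq_zero fun i _ => ?_
      rw [if_neg]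
      rintro rfl
      rw [map_add, Finsupp.degree_single, (Finset.mem_filter.mp hμ).2.1] at hν
      omega
    refine ⟨P', fun ν => ?_, fun ν hν hdeg => ?_, ?_⟩
    · -- coefficients in `R`
      rw [hcoeff]
      refine add_mem (sub_mem (hPR ν) ?_) (sum_mem fun μ hμ => sum_mem fun i _ => ?_)
      · split_ifs
        · exact hPR ν
        · exact R.zero_mem
      · split_ifs
        · exact ((hd μ) hμ).1 i
        · exact R.zero_mem
    · -- unit coefficients below degree `N + 1`
      have hν0 : P'.coeff ν ≠ 0 := MvPolynomial.mem_support_iff.mp hν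
      have hdeg' : Finsupp.degree ν ≤ N := Nat.lt_succ_iff.mp hdeg
      rw [hcoeff, hsum0 ν hdeg', add_zero] at hν0 ⊢
      rcases hdeg'.lt_or_eq with hlt | heq
      · have hνT : ν ∉ T := fun h => by
          have := (Finset.mem_filter.mp h).2.1
          omega
        rw [if_neg hνT, sub_zero] at hν0 ⊢
        exact hPv ν (MvPolynomial.mem_support_iff.mpr hν0) hlt
      · by_cases hνT : ν ∈ T
        · rw [if_pos hνT, sub_self] at hν0
          exact (hν0 rfl).elim
        · rw [if_neg hνT, sub_zero] at hν0 ⊢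
          have hle : O.valuation (P.coeff ν) ≤ 1 :=
            (O.valuation_le_one_iff _).mpr (hRO (hPR ν))
          have hnlt : ¬ O.valuation (P.coeff ν) < 1 := fun h =>
            hνT (Finset.mem_filter.mpr ⟨MvPolynomial.mem_support_iff.mpr hν0, heq, h⟩)
          exact le_antisymm hle (not_lt.mp hnlt)
    · -- the value is unchanged
      have hevalB : ∀ μ ∈ T,
          (∑ i, MvPolynomial.eval x (MvPolynomial.monomial (μ + Finsupp.single i 1) (d μ i))) =
            MvPolynomial.eval x (MvPolynomial.monomial μ (P.coeff μ)) := by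
        intro μ hμ
        rw [hevalA, ((hd μ) hμ).2, Finset.sum_mul]
        refine Finset.sum_congr rfl fun i _ => ?_
        rw [MvPolynomial.monomial_add_single, map_mul, map_pow, hevalA, MvPolynomial.eval_X]
        ring
      rw [hP']
      simp only [map_add, map_sub, map_sum]
      rw [Finset.sum_congr rfl hevalB, sub_add_cancel, hPe]

/-- **Rank one.** If `v(xᵢ) < 1` for all `i` and the value group is archimedean in the sense of
the stub (`∀ z w, v z < 1 → w ≠ 0 → ∃ N, v z ^ N < v w`), then monomials of large degree have
value below `v(a)`. [folklore] -/
theorem perron_exists_bound {n : ℕ} (x : Fin n → K)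
    (harch : ∀ z w : K, O.valuation z < 1 → w ≠ 0 → ∃ N : ℕ, O.valuation z ^ N < O.valuation w)
    (hxlt : ∀ i, O.valuation (x i) < 1) {a : K} (ha0 : a ≠ 0) :
    ∃ N : ℕ, ∀ μ : Fin n →₀ ℕ, N ≤ Finsupp.degree μ →
      (∏ i, O.valuation (x i) ^ (μ i)) < O.valuation a := by
  rcases isEmpty_or_nonempty (Fin n) with hn | hn
  · refine ⟨1, fun μ hμ => ?_⟩
    rw [Finsupp.degree_eq_sum, Finset.univ_eq_empty, Finset.sum_empty] at hμ
    exact absurd hμ (by norm_num)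
  · obtain ⟨i₀, -, hi₀⟩ :=
      Finset.exists_max_image Finset.univ (fun i => O.valuation (x i)) Finset.univ_nonempty
    obtain ⟨N, hN⟩ := harch (x i₀) a (hxlt i₀) ha0
    refine ⟨N, fun μ hμ => lt_of_le_of_lt ?_ hN⟩
    calc (∏ i, O.valuation (x i) ^ (μ i)) ≤ ∏ i, O.valuation (x i₀) ^ (μ i) :=
          Finset.prod_le_prod' fun i _ => pow_le_pow_left' (hi₀ i (Finset.mem_univ _)) _
      _ = O.valuation (x i₀) ^ Finsupp.degree μ := by
          rw [Finset.prod_pow_eq_pow_sum, Finsupp.degree_eq_sum]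
      _ ≤ O.valuation (x i₀) ^ N := pow_le_pow_right_of_le_one' (hxlt i₀).le hμ

/-- `ℤ`-independence of the values `v(xᵢ)` makes `μ ↦ v(x^μ)` injective on `ℕⁿ`. [folklore] -/
theorem perron_exp_eq_of_val_eq {n : ℕ} (x : Fin n → K) (hvx0 : ∀ i, O.valuation (x i) ≠ 0)
    (hind : ∀ m : Fin n → ℤ, (∏ i, O.valuation (x i) ^ (m i)) = 1 → m = 0)
    {μ ν : Fin n →₀ ℕ}
    (h : (∏ i, O.valuation (x i) ^ (μ i)) = ∏ i, O.valuation (x i) ^ (ν i)) : μ = ν := by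
  have h1 : (∏ i, O.valuation (x i) ^ ((μ i : ℤ) - ν i)) = 1 := by
    simp_rw [zpow_sub₀ (hvx0 _), zpow_natCast, Finset.prod_div_distrib, h]
    exact div_self (Finset.prod_ne_zero_iff.mpr fun i _ => pow_ne_zero _ (hvx0 i))
  have h2 := hind _ h1
  ext i
  have h3 := congr_fun h2 i
  simp only [Pi.zero_apply, sub_eq_zero, Nat.cast_inj] at h3
  exact h3

end Expansion

/-! ### The registered helper stub: the dominant term -/

/-- **The dominant term** (Steps 1–2 of Zariski–Perron on a very good chart, RANK ONE;
registered helper stub of `stub_perronMonomialization`). On a chart `(R, x)` whose centre is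
generated by the non-zero `xᵢ`, with `ℤ`-independent values `v(xᵢ)` and an archimedean value
group, every non-zero `a ∈ R` is a polynomial `∑ c_μ x^μ` in the parameters (an
`MvPolynomial (Fin n) K` with coefficients in `R`, evaluated at `x`) with a distinguished
exponent `μ₀` in its support whose coefficient is a unit of `O` (value `1`) and whose monomial
value `v(x^{μ₀})` strictly dominates the value of every other monomial present: expand to a
depth `N` with `v(x^λ) < v(a)` for `|λ| ≥ N` (`perron_exists_expansion`, `perron_exists_bound`);
the terms of degree `< N` have unit coefficients and pairwise distinct values
(`perron_exp_eq_of_val_eq`), so their maximum `μ₀` is strict and carries the value of `a`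
(`Valuation.map_sum_eq_of_lt`). [cite: Cutkosky2022, proof of Thm. 1.2 (1)] -/
theorem stub_perronDominantTerm :
    ∀ (k K : Type) [Field k] [Field K] [Algebra k K] (O : ValuationSubring K) (n : ℕ) (R : Subalgebra k K) (hRO : R.toSubring ≤ O.toSubring) (x : Fin n → K) (hx : ∀ i, x i ∈ R), (∀ i, x i ≠ 0) → Ideal.span (Set.range fun i => (⟨x i, hx i⟩ : R.toSubring)) = Ideal.comap (Subring.inclusion hRO) (IsLocalRing.maximalIdeal O) → (∀ m : Fin n → ℤ, (∏ i, O.valuation (x i) ^ (m i)) = 1 → m = 0) → (∀ z w : K, O.valuation z < 1 → w ≠ 0 → ∃ N : ℕ, O.valuation z ^ N < O.valuation w) → ∀ a : K, a ∈ R → a ≠ 0 → ∃ (P : MvPolynomial (Fin n) K) (μ₀ : Fin n →₀ ℕ), μ₀ ∈ P.support ∧ (∀ μ, P.coeff μ ∈ R) ∧ O.valuation (P.coeff μ₀) = 1 ∧ (∀ μ ∈ P.support, μ ≠ μ₀ → (∏ i, O.valuation (x i) ^ (μ i)) < ∏ i, O.valuation (x i) ^ (μ₀ i)) ∧ MvPolynomial.eval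 x P = a := by
  intro k K _ _ _ O n R hRO x hx hx0 hcen hind harch a haR ha0
  classical
  have hxlt : ∀ i, O.valuation (x i) < 1 := fun i =>
    (perron_mem_centre_iff O R hRO (hx i)).mp (by rw [← hcen]; exact Ideal.subset_span ⟨i, rfl⟩)
  have hvx0 : ∀ i, O.valuation (x i) ≠ 0 := fun i => (map_ne_zero O.valuation).mpr (hx0 i)
  obtain ⟨N, hN⟩ := perron_exists_bound O x harch hxlt ha0
  obtain ⟨P, hPR, hPv, hPe⟩ := perron_exists_expansion O R hRO x hx hcen N haR
  set f : (Fin n →₀ ℕ) → O.ValueGroup := fun μ => ∏ i, O.valuation (x i) ^ (μ i) with hf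
  have hvmon : ∀ μ : Fin n →₀ ℕ, O.valuation (∏ i, x i ^ (μ i)) = f μ := fun μ => by
    simp only [hf, map_prod, map_pow]
  have hvle : ∀ μ, O.valuation (P.coeff μ) ≤ 1 := fun μ =>
    (O.valuation_le_one_iff _).mpr (hRO (hPR μ))
  set S := P.support.filter fun μ => Finsupp.degree μ < N with hS
  -- the tail has small value
  have htail : O.valuation (∑ μ ∈ P.support.filter (fun μ => ¬ Finsupp.degree μ < N),
      P.coeff μ * ∏ i, x i ^ (μ i)) < O.valuation a := by
    refine Valuation.map_sum_lt _ ((map_ne_zero O.valuation).mpr ha0) fun μ hμ => ?_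
    rw [map_mul, hvmon]
    have hdeg : N ≤ Finsupp.degree μ := not_lt.mp (Finset.mem_filter.mp hμ).2
    exact lt_of_le_of_lt (mul_le_of_le_one_left' (hvle μ)) (hN μ hdeg)
  have hsplit : (∑ μ ∈ S, P.coeff μ * ∏ i, x i ^ (μ i)) +
      ∑ μ ∈ P.support.filter (fun μ => ¬ Finsupp.degree μ < N),
        P.coeff μ * ∏ i, x i ^ (μ i) = a := by
    rw [hS, Finset.sum_filter_add_sum_filter_not, ← MvPolynomial.eval_eq', hPe]
  have hvS : O.valuation (∑ μ ∈ S, P.coeff μ * ∏ i, x i ^ (μ i)) = O.valuation a := by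
    rw [eq_sub_of_add_eq hsplit]
    exact Valuation.map_sub_eq_of_lt_left _ htail
  have hSne : S.Nonempty := by
    by_contra hS0
    rw [Finset.not_nonempty_iff_eq_empty] at hS0
    rw [hS0, Finset.sum_empty, map_zero] at hvS
    exact (map_ne_zero O.valuation).mpr ha0 hvS.symm
  obtain ⟨μ₀, hμ₀S, hmax⟩ := Finset.exists_max_image S f hSne
  have hμ₀supp : μ₀ ∈ P.support := (Finset.mem_filter.mp hμ₀S).1
  have hv1 : O.valuation (P.coeff μ₀) = 1 := hPv μ₀ hμ₀supp (Finset.mem_filter.mp hμ₀S).2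
  have hSlt : ∀ μ ∈ S, μ ≠ μ₀ → f μ < f μ₀ := fun μ hμ hne =>
    lt_of_le_of_ne (hmax μ hμ) fun h => hne (perron_exp_eq_of_val_eq O x hvx0 hind h)
  have hvS' : O.valuation (∑ μ ∈ S, P.coeff μ * ∏ i, x i ^ (μ i)) = f μ₀ := by
    rw [O.valuation.map_sum_eq_of_lt hμ₀S]
    · rw [map_mul, hv1, one_mul, hvmon]
    · intro μ hμ
      rw [Finset.mem_sdiff, Finset.mem_singleton] at hμ
      rw [map_mul, map_mul, hv1, one_mul, hvmon, hvmon]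
      exact lt_of_le_of_lt (mul_le_of_le_one_left' (hvle μ)) (hSlt μ hμ.1 hμ.2)
  refine ⟨P, μ₀, hμ₀supp, hPR, hv1, fun μ hμ hne => ?_, hPe⟩
  by_cases hdeg : Finsupp.degree μ < N
  · exact hSlt μ (Finset.mem_filter.mpr ⟨hμ, hdeg⟩) hne
  · calc f μ < O.valuation a := hN μ (not_lt.mp hdeg)
      _ = f μ₀ := by rw [← hvS, hvS']

end Summit.ResolutionOfSingularities.ResolutionOfSingularities.Theorems.PfaffLine
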